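import Mathlib
import Summits.Ventures.HodgeRepro.Tier4.Target
import Summits.Ventures.HodgeRepro.Tier4.Line3.WittRank3

/-!
# Tier4/Line3/OrthLine — the `H`-orthogonal complement of an independent pair is a line (L3.6a, R-c)

Blind re-derivation cell `pub-hodge-repro`, Tier 4 «PROVE THE STEP» (README §9–§10), LINE L3, seat t4-L3-p1 (prover);
support of the stabiliser finiteness (residual R-c of proofs/t4/L3/L36a-support.md) of L3.6a.

CONTENT.  For `H` invertible and `a, b ∈ E³` linearly independent, the `H`-orthogonal complement
`{v | ⟨a, v⟩_H = 0 ∧ ⟨b, v⟩_H = 0}` is the kernel of the `2×3` matrix with rows `c(a)ᵀ H`, `c(b)ᵀ H`, of rank `2`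
(the rows are independent since `v ↦ v H` is injective and `c` is a ring automorphism), hence one-dimensional:
there is `n ≠ 0` in it and every vector of it is a multiple of `n` (`exists_orth_line`).

Nothing here asserts anything about the truth of (P); HC_CM is NOT proved by anyone in this repository.
-/

set_option autoImplicit false

noncomputable section

namespace Summit.Ventures.HodgeRepro.Tier4.Line3

open Summit.Ventures.HodgeRepro.Tier4
open Matrix Module

section Orth

variable {E : Type*} [Field E] (c : E ≃+* E) (H : Matrix (Fin 3) (Fin 3) E)

/-- The `2×3` matrix with rows `c(a)ᵀ H` and `c(b)ᵀ H`. -/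
def rowsH (a b : Fin 3 → E) : Matrix (Fin 2) (Fin 3) E :=
  Matrix.of ![(fun i => c (a i)) ᵥ* H, (fun i => c (b i)) ᵥ* H]

/-- `rowsH *ᵥ v = (⟨a, v⟩_H, ⟨b, v⟩_H)`. -/
theorem rowsH_mulVec (a b v : Fin 3 → E) :
    rowsH c H a b *ᵥ v = ![hform c H a v, hform c H b v] := by
  funext i
  fin_cases i
  · show ((fun i => c (a i)) ᵥ* H) ⬝ᵥ v = hform c H a v
    rw [← Matrix.dotProduct_mulVec]; rfl
  · show ((fun i => c (b i)) ᵥ* H) ⬝ᵥ v = hform c H b v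
    rw [← Matrix.dotProduct_mulVec]; rfl

/-- The rows of `rowsH` are independent for `H` a unit and `a, b` independent. -/
theorem rowsH_rows_linearIndependent (hH : IsUnit H) {a b : Fin 3 → E}
    (hab : LinearIndependent E ![a, b]) : LinearIndependent E (rowsH c H a b).row := by
  show LinearIndependent E ![(fun i => c (a i)) ᵥ* H, (fun i => c (b i)) ᵥ* H]
  rw [LinearIndependent.pair_iff]
  intro s t hst
  have hinj : Function.Injective (Matrix.vecMul · H) := Matrix.vecMul_injective_iff_isUnit.mpr hH
  have h1 : (s • fun i => c (a i)) + (t • fun i => c (b i)) = 0 := by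
    apply hinj
    show ((s • fun i => c (a i)) + (t • fun i => c (b i))) ᵥ* H = (0 : Fin 3 → E) ᵥ* H
    rw [Matrix.add_vecMul, Matrix.smul_vecMul, Matrix.smul_vecMul, Matrix.zero_vecMul]
    exact hst
  -- apply `c.symm` entrywise
  have h2 : c.symm s • a + c.symm t • b = 0 := by
    funext i
    have := congrFun h1 i
    simp only [Pi.add_apply, Pi.smul_apply, smul_eq_mul, Pi.zero_apply] at this
    apply c.injective
    simp only [Pi.add_apply, Pi.smul_apply, smul_eq_mul, Pi.zero_apply, map_add, map_mul,
      RingEquiv.apply_symm_apply, map_zero]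
    exact this
  obtain ⟨hs, ht⟩ := (LinearIndependent.pair_iff.mp hab) _ _ h2
  exact ⟨by simpa using congrArg c hs, by simpa using congrArg c ht⟩

/-- `rowsH` has rank `2`. -/
theorem rowsH_rank (hH : IsUnit H) {a b : Fin 3 → E} (hab : LinearIndependent E ![a, b]) :
    (rowsH c H a b).rank = 2 := by
  rw [Matrix.rank_eq_finrank_span_row, finrank_span_eq_card (rowsH_rows_linearIndependent c H hH hab)]
  simp

/-- **THE ORTHOGONAL COMPLEMENT OF AN INDEPENDENT PAIR IS A LINE**: there is `n ≠ 0` with `⟨a, n⟩_H = ⟨b, n⟩_H = 0`,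
and every `v` with `⟨a, v⟩_H = ⟨b, v⟩_H = 0` is a multiple of `n`. -/
theorem exists_orth_line (hH : IsUnit H) {a b : Fin 3 → E} (hab : LinearIndependent E ![a, b]) :
    ∃ n : Fin 3 → E, n ≠ 0 ∧ hform c H a n = 0 ∧ hform c H b n = 0 ∧
      ∀ v : Fin 3 → E, hform c H a v = 0 → hform c H b v = 0 → ∃ s : E, v = s • n := by
  set f := (rowsH c H a b).mulVecLin with hf
  have hker : ∀ v, v ∈ LinearMap.ker f ↔ hform c H a v = 0 ∧ hform c H b v = 0 := by
    intro v
    rw [LinearMap.mem_ker, hf, Matrix.mulVecLin_apply, rowsH_mulVec]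
    constructor
    · intro h
      exact ⟨by simpa using congrFun h 0, by simpa using congrFun h 1⟩
    · rintro ⟨h0, h1⟩
      funext i
      fin_cases i <;> simp [h0, h1]
  have hrank : finrank E (LinearMap.range f) = 2 := rowsH_rank c H hH hab
  have hsum := LinearMap.finrank_range_add_finrank_ker f
  rw [hrank, Module.finrank_fin_fun] at hsum
  have hker1 : finrank E (LinearMap.ker f) = 1 := by omega
  have hpos : 0 < finrank E (LinearMap.ker f) := by rw [hker1]; exact one_pos
  obtain ⟨⟨n, hn⟩, hn0⟩ := Module.finrank_pos_iff_exists_ne_zero.mp hpos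
  have hn0' : n ≠ 0 := fun h => hn0 (Subtype.ext h)
  obtain ⟨ha, hb⟩ := (hker n).mp hn
  refine ⟨n, hn0', ha, hb, fun v hva hvb => ?_⟩
  have hmem : v ∈ LinearMap.ker f := (hker v).mpr ⟨hva, hvb⟩
  obtain ⟨s, hs⟩ := (finrank_eq_one_iff_of_nonzero' (⟨n, hn⟩ : LinearMap.ker f) (fun h => hn0 h)).mp hker1
    ⟨v, hmem⟩
  exact ⟨s, by simpa using (congrArg Subtype.val hs).symm⟩

end Orth

end Summit.Ventures.HodgeRepro.Tier4.Line3

end
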